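import Summits.QuantumFields.BalabanUV.T4Continuum.Support.NE7K1LinCovDecayAbstract
import Summits.QuantumFields.BalabanUV.T4Continuum.Support.NE7K1LinTorusResolventInverse
import Summits.QuantumFields.BalabanUV.T4Continuum.Support.NE7K1LinTorusRho

/-!
# NE7K1LinTorusCov237 — row NE7 (node U5), candidate route HOM, path H1L, cell K1-lin(s): NEEDS-ESTIMATE #E1 (o2), TORUS VARIANT —
# B4 (1.13)–(1.15) AND (2.37) FOR THE TWO-CUTOFF LINE ON THE DOUBLED TORUS: the unit-torus operator `Δ_s^{𝕋} = aI − a²Q_n(T^𝕋(s) + aQ_n^*Q_n)⁻¹Q_n^*`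
# on the representatives `boxDom (2M)`, `γ₀I ≤ Δ_s^{𝕋} + a₂L_P^{−2}P ≤ γ₁I`, and `|C_s^{𝕋}(y, y′)| ≤ c·e^{−δ·dist_𝕋(y,y′)}` with `δ, c` in
# `(d, ℓ, a±, a₂±)` ONLY, every `s ∈ [0,1]`, every mesh `n`, `L`, torus `M = L_P·M₀` (PRICING-NE7 v39 N-40-5 «torus first», v40 A-41-6)

Lineage `b2b-balaban-t4-ne7-p2` (CRUX PROVER NE7 #2), generation 77; file 84 = the TORUS INSTANCE of files 83a∕83b (`NE7K1LinCovEnergyAbstract`,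
`NE7K1LinCovDecayAbstract`).  The desk (v40 §292, A-41-6) recorded lens 2's S-81-1: the torus floor needs `inv_form_antitone (P := torOpK) (Q := torLineRepA … s)`
plus an `s = 0` anchor.  THIS FILE takes a shorter road that needs NO torus Dirichlet-form layer: on the representatives `𝕋 = boxDom (2nM)` the fine
doubled-torus line DOMINATES Bałaban's NN Neumann box operator of the same point set —
`⟨g, boxOpR n a 0 (2M) g⟩ = ⟨g, fineOpR n a 0 𝕋 g⟩ ≤ ⟨g, torOpK n a (nM) 𝕋 g⟩ ≤ ⟨g, (T^𝕋(s) + aQ_n^*Q_n) g⟩` (file 36's `form_torOpK_ge`: the periodic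
operator is the Neumann one plus the nonnegative Laplacian of the wrap-around bonds; file 39's `torOpK_form_le_torLineRep`: `n²(−Δ^𝕋) ⪯ T^𝕋(s)`; the
`a`-terms agree, file 74's `torLineRepA_apply`) — so file 83's hypothesis class is met with the SAME b04 constant, and the coercivity of
`Δ_s^{𝕋} + a₂L_P^{−2}P` follows from the Neumann bond form of the representatives' box, which the periodic form only exceeds.

* §1 `fineTorEquiv`, **`torLineT L hn ℓ M₀ a s`** (file 74's `torLineRepA` on b04's fine index `↥(boxDom (n·L_P·2M₀))`), `torLineT_form`, `torLineT_isSymm`,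
  `torLineT_mul_inv` (file 76's `isUnit_det_torLineRepA`), **`boxOpR_form_le_torLineT`** (THE TORUS LEVER).
* (file 84a `NE7K1LinTorusRho`) THE TORUS PSEUDO-DISTANCE `rhoT` (`= torusSupNorm (2M) (y − y′)`): `rhoT_isPseudoDist`, `rhoT_le_supNorm`, `rhoT_sumBound`.
* §3 THE BLOCK-ROW BOUND IN THE TORUS DISTANCE: `torLineT_inv_cast` (the complex inverse of file 76 is the cast of the real one), **`torLineT_blockRow_bound`**:
  `|Σ_{x′ ∈ B(y′)} (T^𝕋(s) + aQ_n^*Q_n)⁻¹(x, x′)| ≤ M_line(d,a₋)·periodConst(κ_line)·e^{−(κ_line∕(d+1))·ρ_𝕋(blk_n x, y′)}` (file 76's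
  `resolventKernel_eq_torusKernelS` + file 68's `line_torusKernel_decay_torusMetric` — NO images, NO `2^{d+1}`).
* §4 **`cov237T_decay`** — (2.37) ON THE TORUS: `∃ δ, c > 0` in `(d, ℓ, a₋, a₊, a₂₋, a₂₊)` with `|(Δ_s^{𝕋} + a₂L_P^{−2}P)⁻¹(y,y′)| ≤ c·e^{−δρ_𝕋(y,y′)}` and the
  inverse genuine, for EVERY `n ≥ 1`, `s ∈ [0,1]`, `a ∈ [a₋,a₊]`, `a₂ ∈ [a₂₋,a₂₊]`, `L ≥ 1`, torus `M₀`; **`cov237T_form_bounds`** — (1.15) on the torus.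

HONEST FRAMING: [folklore]; the instance of files 83a∕83b with the lineage's torus objects BY NAME; A = 0; the coarse torus is `Π_μ ℤ∕2L_P M₀,μ` (the
lineage's doubled torus, blocks of the next step aligned); the zero mode is carried by the `a₂L_P^{−2}P` term exactly as in B4 (1.13); nothing of
Bałaban's asserted; no `sorry`.  Census only ((o2) torus variant); NE7 NOT PRINTED ∕ NOT PROVED; spine 0∕9; FIXED FINITE T⁴, rung (B)+1; NOT infinite
volume, NOT mass gap, NOT Clay.  HONEST DEPENDENCY: continuum YM on T⁴ ⇐ BetaPertH ∧ nine spine estimates (0/9 proved); BetaPertH ⇐ (D1) ∧ (D4) ∧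
CAP+tail; G-an2-4 gates asym, D1 and NE2/3/4.
-/

noncomputable section

open Finset Matrix

namespace Summit.QuantumFields.BalabanUV.T4Continuum.NE7K1LinTorusCov237

open Literature.MathematicalPhysics.QuantumFieldTheory.Balaban1983to89
open Literature.MathematicalPhysics.QuantumFieldTheory.Balaban1983to89.B4Reflection242
open Literature.MathematicalPhysics.QuantumFieldTheory.Balaban1983to89.B4Lower18
open Literature.MathematicalPhysics.QuantumFieldTheory.Balaban1983to89.B4ContourShift (supNorm supNorm_nonneg abs_le_supNorm)
open Literature.MathematicalPhysics.QuantumFieldTheory.Balaban1983to89.B4BoxCov237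
open Literature.MathematicalPhysics.QuantumFieldTheory.Balaban1983to89.B4TorusKernel (periodConst)
open Literature.MathematicalPhysics.QuantumFieldTheory.Balaban1983to89.B4TorusKernel.MultiPeriod (torusSupNorm circAbs centre centreVec
  translate circAbs_add_mul abs_add_mul_centre circAbs_le_abs circAbs_nonneg supNorm_translate_centreVec torusSupNorm_le_supNorm)
open Literature.MathematicalPhysics.QuantumFieldTheory.Balaban1983to89.B4TorusPositivity (wrap)
open Literature.MathematicalPhysics.QuantumFieldTheory.Balaban1983to89.B4Green244 (finePt coarse offset coarse_finePt finePt_coarse_offset)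
open Literature.MathematicalPhysics.QuantumFieldTheory.Balaban1983to89.B4Green242Bridge (zero_mem_boxDom)
open Literature.MathematicalPhysics.QuantumFieldTheory.Balaban1983to89.B4Sect5Torus (IsPseudoDist SumBound Hyp56 rate rate_pos inv_decay)
open Literature.MathematicalPhysics.QuantumFieldTheory.Balaban1983to89.B4Sect5Proof (latticeConst latticeConst_nonneg latticeSum_le)
open NE7K1LinFoldKernels NE7K1LinFoldMatrices NE7K1LinSchurFoldBox NE7K1LinSchurLineU1 NE7K1LinTorusChart NE7K1LinTorusFloor
open NE7K1LinTorusLineSymbol NE7K1LinTorusLineASplit NE7K1LinTorusResolventLine NE7K1LinTorusResolventInverse NE7K1LinTorusSymbolReal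
open NE7K1LinStripClassLine NE7K1LinStripClassLineDecay NE7K1LinCovEnergyAbstract NE7K1LinCovDecayAbstract NE7K1LinTorusRho

variable {d : ℕ}

/-! ### §1 The torus line on b04's fine index and the torus lever -/

section Line

variable {n : ℕ} (L : ℕ) [NeZero L] {ℓ : ℕ} {M₀ : Fin (d + 1) → ℕ}

/-- the period vectors agree: `dbl (n·L_P·M₀) = n·(L_P·2M₀)`. [folklore] -/
theorem finePeriod_eq (n ℓ : ℕ) (M₀ : Fin (d + 1) → ℕ) :
    (dbl fun i => n * ((ℓ + 1) * M₀ i)) = fun i => n * ((ℓ + 1) * (2 * M₀ i)) := by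
  funext i; simp only [dbl_apply]; ring

/-- the unit period vectors agree: `dbl (L_P·M₀) = L_P·2M₀`. [folklore] -/
theorem unitPeriod_eq (ℓ : ℕ) (M₀ : Fin (d + 1) → ℕ) : (dbl fun i => (ℓ + 1) * M₀ i) = fun i => (ℓ + 1) * (2 * M₀ i) := by
  funext i; simp only [dbl_apply]; ring

/-- the representatives of the fine doubled torus as b04's fine box index. [folklore] -/
def fineTorEquiv (n ℓ : ℕ) (M₀ : Fin (d + 1) → ℕ) :
    ↥(boxDom (dbl fun i => n * ((ℓ + 1) * M₀ i))) ≃ ↥(boxDom fun i => n * ((ℓ + 1) * (2 * M₀ i))) :=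
  Equiv.subtypeEquivRight (fun x => by rw [finePeriod_eq])

/-- **THE TORUS LINE** `T^𝕋(s) + a·Q_n^*Q_n` (file 74's `torLineRepA`) on b04's fine index. [folklore] -/
def torLineT (hn : 1 ≤ n) (ℓ : ℕ) (M₀ : Fin (d + 1) → ℕ) (a s : ℝ) :
    Matrix ↥(boxDom fun i => n * ((ℓ + 1) * (2 * M₀ i))) ↥(boxDom fun i => n * ((ℓ + 1) * (2 * M₀ i))) ℝ :=
  Matrix.reindex (fineTorEquiv n ℓ M₀) (fineTorEquiv n ℓ M₀) (torLineRepA (L := L) hn (fun i => (ℓ + 1) * M₀ i) a s)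

/-- forms transport along the reindexing. [folklore] -/
theorem torLineT_form (hn : 1 ≤ n) (a s : ℝ) (v : ↥(boxDom fun i => n * ((ℓ + 1) * (2 * M₀ i))) → ℝ) :
    v ⬝ᵥ (torLineT L hn ℓ M₀ a s).mulVec v =
      (v ∘ fineTorEquiv n ℓ M₀) ⬝ᵥ (torLineRepA (L := L) hn (fun i => (ℓ + 1) * M₀ i) a s).mulVec (v ∘ fineTorEquiv n ℓ M₀) := by
  simp only [dotProduct, Matrix.mulVec, torLineT, Matrix.reindex_apply, Matrix.submatrix_apply, Function.comp]
  rw [← Equiv.sum_comp (fineTorEquiv n ℓ M₀)]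
  refine Finset.sum_congr rfl fun x _ => ?_
  rw [← Equiv.sum_comp (fineTorEquiv n ℓ M₀)]
  simp only [Equiv.symm_apply_apply]

/-- forms transport for a general matrix on the representatives. [folklore] -/
theorem reindex_form (X : Matrix ↥(boxDom (dbl fun i => n * ((ℓ + 1) * M₀ i))) ↥(boxDom (dbl fun i => n * ((ℓ + 1) * M₀ i))) ℝ)
    (v : ↥(boxDom fun i => n * ((ℓ + 1) * (2 * M₀ i))) → ℝ) :
    v ⬝ᵥ (Matrix.reindex (fineTorEquiv n ℓ M₀) (fineTorEquiv n ℓ M₀) X).mulVec v =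
      (v ∘ fineTorEquiv n ℓ M₀) ⬝ᵥ X.mulVec (v ∘ fineTorEquiv n ℓ M₀) := by
  simp only [dotProduct, Matrix.mulVec, Matrix.reindex_apply, Matrix.submatrix_apply, Function.comp]
  rw [← Equiv.sum_comp (fineTorEquiv n ℓ M₀)]
  refine Finset.sum_congr rfl fun x _ => ?_
  rw [← Equiv.sum_comp (fineTorEquiv n ℓ M₀)]
  simp only [Equiv.symm_apply_apply]

omit [NeZero L] in
/-- b04's `boxOpR n a 0 (L_P·2M₀)` IS the reindexed Neumann operator `fineOpR n a 0` of the representatives' box. [folklore] -/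
theorem boxOpR_eq_reindex_fineOpR (n : ℕ) (a : ℝ) (ℓ : ℕ) (M₀ : Fin (d + 1) → ℕ) :
    boxOpR n a 0 (fun i => (ℓ + 1) * (2 * M₀ i)) =
      Matrix.reindex (fineTorEquiv n ℓ M₀) (fineTorEquiv n ℓ M₀) (fineOpR n a 0 (boxDom (dbl fun i => n * ((ℓ + 1) * M₀ i)))) := by
  rw [← fineOpR_boxDom]
  ext x y
  simp only [Matrix.reindex_apply, Matrix.submatrix_apply, fineOpR, regionOpR, Matrix.of_apply]
  have hx : ((fineTorEquiv n ℓ M₀).symm x).1 = x.1 := rfl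
  have hy : ((fineTorEquiv n ℓ M₀).symm y).1 = y.1 := rfl
  rw [hx, hy, finePeriod_eq]

/-- the transported line splits off its `a`-term: `torLineRepA = torLineRep + (a∕n^{d+1})·blockInd` (file 74's `torLineRepA_apply`). [folklore] -/
theorem torLineRepA_eq_add (hn : 1 ≤ n) (M : Fin (d + 1) → ℕ) (a s : ℝ) :
    torLineRepA (L := L) hn M a s = torLineRep (L := L) hn M s + (a * ((n : ℝ) ^ (d + 1))⁻¹) • blockInd n (boxDom (dbl fun i => n * M i)) := by
  ext x y
  rw [torLineRepA_apply, Matrix.add_apply, Matrix.smul_apply, blockInd_apply, smul_eq_mul, mul_ite, mul_one, mul_zero]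

/-- the periodic operator with its `a`-term is below the transported line: `⟨φ, torOpK n a φ⟩ ≤ ⟨φ, torLineRepA(a,s) φ⟩`, `s ≥ 0`. [folklore] -/
theorem torOpK_form_le_torLineRepA (hn : 1 ≤ n) {M : Fin (d + 1) → ℕ} (hM : ∀ i, 1 ≤ M i) (a : ℝ) {s : ℝ} (hs : 0 ≤ s)
    (φ : ↥(boxDom (dbl fun i => n * M i)) → ℝ) :
    φ ⬝ᵥ (torOpK n a (fun i => n * M i) (boxDom (dbl fun i => n * M i))).mulVec φ ≤
      φ ⬝ᵥ (torLineRepA (L := L) hn M a s).mulVec φ := by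
  have h0 := torOpK_form_le_torLineRep (L := L) hn hM hs φ
  rw [torLineRepA_eq_add L hn M a s, torOpK_eq_add n a, Matrix.add_mulVec, Matrix.add_mulVec, dotProduct_add, dotProduct_add]
  exact add_le_add h0 le_rfl

/-- **THE TORUS LEVER**: `⟨g, boxOpR n a 0 (L_P·2M₀) g⟩ ≤ ⟨g, (T^𝕋(s) + aQ_n^*Q_n) g⟩` for `s ≥ 0` — the Neumann operator of the representatives'
box ⪯ the periodic operator (`form_torOpK_ge`) ⪯ the torus line (`torOpK_form_le_torLineRep`; the `a`-terms agree). [folklore] -/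
theorem boxOpR_form_le_torLineT (hn : 1 ≤ n) (hM₀ : ∀ i, 1 ≤ M₀ i) (a : ℝ) {s : ℝ} (hs : 0 ≤ s)
    (g : ↥(boxDom fun i => n * ((ℓ + 1) * (2 * M₀ i))) → ℝ) :
    g ⬝ᵥ (boxOpR n a 0 (fun i => (ℓ + 1) * (2 * M₀ i))).mulVec g ≤ g ⬝ᵥ (torLineT L hn ℓ M₀ a s).mulVec g := by
  have hM : ∀ i, 1 ≤ (ℓ + 1) * M₀ i := fun i => by nlinarith [hM₀ i]
  have h1 := form_torOpK_ge n a (N := fun i => n * ((ℓ + 1) * M₀ i)) (F := boxDom (dbl fun i => n * ((ℓ + 1) * M₀ i)))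
    (mul_pos_side hn hM) rfl (g ∘ fineTorEquiv n ℓ M₀)
  have h2 := torOpK_form_le_torLineRepA L hn hM a hs (g ∘ fineTorEquiv n ℓ M₀)
  have eL : g ⬝ᵥ (boxOpR n a 0 (fun i => (ℓ + 1) * (2 * M₀ i))).mulVec g =
      (g ∘ fineTorEquiv n ℓ M₀) ⬝ᵥ (fineOpR n a 0 (boxDom (dbl fun i => n * ((ℓ + 1) * M₀ i)))).mulVec (g ∘ fineTorEquiv n ℓ M₀) :=
    (congrArg (fun X : Matrix ↥(boxDom fun i => n * ((ℓ + 1) * (2 * M₀ i))) ↥(boxDom fun i => n * ((ℓ + 1) * (2 * M₀ i))) ℝ =>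
      g ⬝ᵥ X.mulVec g) (boxOpR_eq_reindex_fineOpR n a ℓ M₀)).trans (reindex_form _ g)
  exact eL.trans_le ((h1.trans h2).trans_eq (torLineT_form L hn a s g).symm)

/-- symmetry of the torus line. [folklore] -/
theorem torLineT_isSymm (hn : 1 ≤ n) (a s : ℝ) : (torLineT L hn ℓ M₀ a s).IsSymm := by
  have h : (torLineRepA (L := L) hn (fun i => (ℓ + 1) * M₀ i) a s).IsSymm := by
    ext x y
    simp only [transpose_apply]
    unfold torLineRepA
    exact (torLine_isSymm _ rfl (image_fineTor (NeZero.one_le : 1 ≤ L) n _) n a s).apply _ _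
  unfold torLineT
  rw [Matrix.reindex_apply]
  exact h.submatrix _

/-- `T′·T′⁻¹ = 1` for `a > 0`, `0 ≤ s ≤ 1` (file 76's `isUnit_det_torLineRepA`). [folklore] -/
theorem torLineT_mul_inv (hn : 1 ≤ n) (hM₀ : ∀ i, 1 ≤ M₀ i) {a : ℝ} (ha : 0 < a) {s : ℝ} (hs0 : 0 ≤ s) (hs1 : s ≤ 1) :
    torLineT L hn ℓ M₀ a s * (torLineT L hn ℓ M₀ a s)⁻¹ = 1 := by
  have hM : ∀ i, 1 ≤ (ℓ + 1) * M₀ i := fun i => by nlinarith [hM₀ i]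
  refine Matrix.mul_nonsing_inv _ ?_
  rw [torLineT, Matrix.det_reindex_self]
  exact isUnit_det_torLineRepA (L := L) hn hM ha hs0 hs1

end Line

/-! ### §3 The block-row bound of the torus line's Green function in the torus distance -/

section Row

variable {n : ℕ} (L : ℕ) [NeZero L] {ℓ : ℕ} {M₀ : Fin (d + 1) → ℕ}

/-- the complex inverse of file 76 is the cast of the real inverse. [folklore] -/
theorem torLineRepA_map_inv (hn : 1 ≤ n) {M : Fin (d + 1) → ℕ} (hM : ∀ i, 1 ≤ M i) {a : ℝ} (ha : 0 < a) {s : ℝ} (hs0 : 0 ≤ s)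
    (hs1 : s ≤ 1) :
    ((torLineRepA (L := L) hn M a s).map Complex.ofReal)⁻¹ = (torLineRepA (L := L) hn M a s)⁻¹.map Complex.ofReal := by
  set T := torLineRepA (L := L) hn M a s with hT
  have hdet : IsUnit T.det := isUnit_det_torLineRepA (L := L) hn hM ha hs0 hs1
  refine Matrix.inv_eq_right_inv ?_
  have e : (Complex.ofReal : ℝ → ℂ) = ⇑Complex.ofRealHom := rfl
  rw [e, ← Matrix.map_mul, Matrix.mul_nonsing_inv T hdet, Matrix.map_one _ (map_zero _) (map_one _)]

/-- **THE BLOCK-ROW BOUND IN THE TORUS DISTANCE**: for `a ∈ [a₋,a₊]`, `0 ≤ s ≤ 1`, every fine representative `x` and unit representative `y′`: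
`|Σ_{x′ : blk_n x′ = y′} (T^𝕋(s) + aQ_n^*Q_n)⁻¹(x, x′)| ≤ M_line(d,a₋)·periodConst(κ_line(d+1,a₋,a₊), d)·e^{−(κ_line∕(d+1))·dist_𝕋(blk_n x, y′)}`. [folklore] -/
theorem torLineT_blockRow_bound (hn : 1 ≤ n) (hM₀ : ∀ i, 1 ≤ M₀ i) {aminus aplus a : ℝ} (ha : 0 < aminus) (ha1 : aminus ≤ a)
    (ha2 : a ≤ aplus) {s : ℝ} (hs0 : 0 ≤ s) (hs1 : s ≤ 1) (x : ↥(boxDom fun i => n * ((ℓ + 1) * (2 * M₀ i))))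
    (y y' : ↥(boxDom fun i => (ℓ + 1) * (2 * M₀ i))) (hxy : blk n x.1 = y.1) :
    |∑ x' ∈ Finset.univ.filter (fun x' : ↥(boxDom fun i => n * ((ℓ + 1) * (2 * M₀ i))) => blk n x'.1 = y'.1),
        (torLineT L hn ℓ M₀ a s)⁻¹ x x'|
      ≤ Mline d aminus * periodConst (kappaLine (d + 1) aminus aplus) d *
        Real.exp (-(kappaLine (d + 1) aminus aplus / (d + 1) * rhoT (fun i => (ℓ + 1) * (2 * M₀ i)) y y')) := by
  haveI : NeZero n := ⟨by omega⟩
  have hM : ∀ i, 1 ≤ (ℓ + 1) * M₀ i := fun i => by nlinarith [hM₀ i]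
  have ha0 : 0 < a := lt_of_lt_of_le ha ha1
  set e := fineTorEquiv n ℓ M₀ with he
  -- file 76's docking at the representative `e⁻¹ x`, block label `blk_n x = y`, source `y′`
  have hx : (e.symm x).1 = finePt n (coarse n x.1) (offset n x.1) := (finePt_coarse_offset n x.1).symm
  have hy' : y'.1 ∈ boxDom (dbl fun i => (ℓ + 1) * M₀ i) := by rw [unitPeriod_eq]; exact y'.2
  have hdock := resolventKernel_eq_torusKernelS (L := L) hn hM ha0 hs0 hs1 (e.symm x) hx hy'
  -- the complex sum is the cast of the real filtered sum of the transported inverse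
  have hsum : (∑ z' : ↥(boxDom (dbl fun i => n * ((ℓ + 1) * M₀ i))),
      ((torLineRepA (L := L) hn (fun i => (ℓ + 1) * M₀ i) a s).map Complex.ofReal)⁻¹ (e.symm x) z' *
        (if blk n z'.1 = y'.1 then (1 : ℂ) else 0)) =
      ((∑ x' ∈ Finset.univ.filter (fun x' : ↥(boxDom fun i => n * ((ℓ + 1) * (2 * M₀ i))) => blk n x'.1 = y'.1),
        (torLineT L hn ℓ M₀ a s)⁻¹ x x' : ℝ) : ℂ) := by
    rw [torLineRepA_map_inv L hn hM ha0 hs0 hs1, Finset.sum_filter, ← Equiv.sum_comp e.symm]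
    push_cast
    refine Finset.sum_congr rfl fun x' _ => ?_
    have hinv : (torLineT L hn ℓ M₀ a s)⁻¹ x x' = (torLineRepA (L := L) hn (fun i => (ℓ + 1) * M₀ i) a s)⁻¹ (e.symm x) (e.symm x') := by
      rw [torLineT, Matrix.inv_reindex]; simp [Matrix.reindex_apply, Matrix.submatrix_apply, he]
    rw [hinv, Matrix.map_apply]
    have hx' : (e.symm x').1 = x'.1 := rfl
    rw [hx']
    split_ifs <;> simp
  rw [hsum] at hdock
  have hreal : |∑ x' ∈ Finset.univ.filter (fun x' : ↥(boxDom fun i => n * ((ℓ + 1) * (2 * M₀ i))) => blk n x'.1 = y'.1),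
      (torLineT L hn ℓ M₀ a s)⁻¹ x x'| = ‖torusKernelS n (lineSymb L n s) a (offset n x.1) (dbl fun i => (ℓ + 1) * M₀ i) (coarse n x.1 - y'.1)‖ := by
    rw [← hdock, Complex.norm_real, Real.norm_eq_abs]
  rw [hreal]
  have hb := line_torusKernel_decay_torusMetric L n hs0 hs1 ha ha1 ha2 (offset n x.1) (dbl_pos hM) (coarse n x.1 - y'.1)
  have hco : coarse n x.1 = y.1 := hxy
  have hρ : torusSupNorm (dbl fun i => (ℓ + 1) * M₀ i) (coarse n x.1 - y'.1) = rhoT (fun i => (ℓ + 1) * (2 * M₀ i)) y y' := by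
    rw [hco, unitPeriod_eq]; rfl
  rw [hρ] at hb
  exact hb

end Row

/-! ### §4 (1.15) and (2.37) for the two-cutoff line on the doubled torus -/

section Decay

/-- the torus-decay constant of file 68, clipped at `0`. [folklore] -/
def CTor (d : ℕ) (aminus aplus : ℝ) : ℝ := max (Mline d aminus * periodConst (kappaLine (d + 1) aminus aplus) d) 0

/-- `0 ≤ C_𝕋`. [folklore] -/
theorem CTor_nonneg (d : ℕ) (aminus aplus : ℝ) : 0 ≤ CTor d aminus aplus := le_max_right _ _

/-- **B4 LEMMA 2.4 (2.37) FOR THE TWO-CUTOFF LINE ON THE DOUBLED TORUS.**  For every dimension `d + 1`, next-step block `L_P = ℓ + 1 ≥ 2`, window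
`a ∈ [a₋,a₊]` (`a₋ > 0`), `a₂ ∈ [a₂₋,a₂₊]` (`a₂₋ > 0`) and refinement `L ≥ 1` there are `δ, c > 0` — functions of `(d, ℓ, a₋, a₊, a₂₋, a₂₊)` ALONE — such
that for EVERY mesh `n ≥ 1`, EVERY `s ∈ [0,1]` and EVERY torus `Π_μ ℤ∕2L_P M₀,μ`: `Δ_s^{𝕋} + a₂L_P^{−2}P` is invertible and
`|(Δ_s^{𝕋} + a₂L_P^{−2}P)⁻¹(y, y′)| ≤ c·e^{−δ·dist_𝕋(y,y′)}` for all unit representatives `y, y′`. [folklore] -/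
theorem cov237T_decay (d ℓ : ℕ) (hℓ : 1 ≤ ℓ) (aminus aplus a2minus a2plus : ℝ) (ha : 0 < aminus) (ha2 : 0 < a2minus)
    (L : ℕ) [NeZero L] :
    ∃ δ c : ℝ, 0 < δ ∧ 0 < c ∧ ∀ (n : ℕ) (hn : 1 ≤ n) (a a₂ s : ℝ), aminus ≤ a → a ≤ aplus → a2minus ≤ a₂ → a₂ ≤ a2plus →
      0 ≤ s → s ≤ 1 → ∀ (M₀ : Fin (d + 1) → ℕ), (∀ i, 1 ≤ M₀ i) →
        covOpG n ℓ (fun i => 2 * M₀ i) a a₂ (torLineT L hn ℓ M₀ a s) * (covOpG n ℓ (fun i => 2 * M₀ i) a a₂ (torLineT L hn ℓ M₀ a s))⁻¹ = 1 ∧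
        ∀ y y' : ↥(boxDom fun i => (ℓ + 1) * (2 * M₀ i)),
          |(covOpG n ℓ (fun i => 2 * M₀ i) a a₂ (torLineT L hn ℓ M₀ a s))⁻¹ y y'| ≤
            c * Real.exp (-(δ * rhoT (fun i => (ℓ + 1) * (2 * M₀ i)) y y')) := by
  set κ : ℝ := kappaLine (d + 1) aminus aplus / (d + 1) with hκdef
  set C : ℝ := CTor d aminus aplus with hCdef
  have hκ : 0 < κ := div_pos (kappaLine_pos (d + 1) aplus ha) (by positivity)
  have hC : 0 ≤ C := CTor_nonneg d aminus aplus
  set γ₀ : ℝ := min (min (aminus / (8 * (d + 1))) (1 / 8) / ((ℓ : ℝ) * (ℓ + 1) / 2)) (a2minus / ((ℓ : ℝ) + 1) ^ 2) with hγ₀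
  set c₀ : ℝ := |aplus| + aplus ^ 2 * C + |a2plus| * Real.exp (κ * ℓ) with hc₀
  have hℓ1 : (1 : ℝ) ≤ ℓ := by exact_mod_cast hℓ
  have hγ : 0 < γ₀ := lt_min (by positivity) (by positivity)
  have hc : 0 ≤ c₀ := by positivity
  have hKn : ∀ t : ℝ, 0 < t → 0 ≤ latticeConst (d + 1) t := fun t ht => latticeConst_nonneg (d + 1) ht.le
  refine ⟨rate (latticeConst (d + 1)) γ₀ c₀ κ, 2 / γ₀, rate_pos hKn hγ hc hκ, by positivity, ?_⟩
  intro n hn a a₂ s h1 h2 h5 h6 hs0 hs1 M₀ hM₀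
  have ha₁ : 0 < a := lt_of_lt_of_le ha h1
  have hP : ∀ i, 1 ≤ (ℓ + 1) * (2 * M₀ i) := fun i => by nlinarith [hM₀ i]
  have hTG := torLineT_mul_inv L hn hM₀ ha₁ hs0 hs1 (ℓ := ℓ)
  have hTs := torLineT_isSymm L hn a s (ℓ := ℓ) (M₀ := M₀)
  have hlev : ∀ g, g ⬝ᵥ (boxOpR n a 0 (fun i => (ℓ + 1) * (2 * M₀ i))).mulVec g ≤ g ⬝ᵥ (torLineT L hn ℓ M₀ a s).mulVec g :=
    fun g => boxOpR_form_le_torLineT L hn hM₀ a hs0 g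
  have hrow : ∀ (x : ↥(boxDom fun i => n * ((ℓ + 1) * (2 * M₀ i)))) (y y' : ↥(boxDom fun i => (ℓ + 1) * (2 * M₀ i))),
      blk n x.1 = y.1 →
      |∑ x' ∈ Finset.univ.filter (fun x' : ↥(boxDom fun i => n * ((ℓ + 1) * (2 * M₀ i))) => blk n x'.1 = y'.1),
        (torLineT L hn ℓ M₀ a s)⁻¹ x x'| ≤ C * Real.exp (-(κ * rhoT (fun i => (ℓ + 1) * (2 * M₀ i)) y y')) := by
    intro x y y' hxy
    exact (torLineT_blockRow_bound L hn hM₀ ha h1 h2 hs0 hs1 x y y' hxy).trans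
      (mul_le_mul_of_nonneg_right (le_max_left _ _) (Real.exp_pos _).le)
  exact ⟨covOpG_mul_inv _ hn hℓ ha₁ (lt_of_lt_of_le ha2 h5) hTG hlev,
    fun y y' => covOpG_inv_decay _ hn hℓ (rhoT_isPseudoDist hP) (rhoT_le_supNorm hP) hKn (rhoT_sumBound hP) hC hκ ha h1 h2 ha2 h5 h6
      hTs hTG hlev hrow y y'⟩

/-- **B4 PROP. 2.3 (1.15) FOR THE LINE ON THE DOUBLED TORUS** — `γ₀‖ω‖² ≤ ⟨ω, (Δ_s^{𝕋} + a₂L_P^{−2}P)ω⟩ ≤ γ₁‖ω‖²`, `γ₀, γ₁` in `(d, ℓ, a±, a₂±)` only.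
[folklore] -/
theorem cov237T_form_bounds (d ℓ : ℕ) (hℓ : 1 ≤ ℓ) (aminus aplus a2minus a2plus : ℝ) (ha : 0 < aminus) (ha2 : 0 < a2minus)
    (L : ℕ) [NeZero L] :
    ∃ γ₀ γ₁ : ℝ, 0 < γ₀ ∧ γ₀ ≤ γ₁ ∧ ∀ (n : ℕ) (hn : 1 ≤ n) (a a₂ s : ℝ), aminus ≤ a → a ≤ aplus → a2minus ≤ a₂ → a₂ ≤ a2plus →
      0 ≤ s → s ≤ 1 → ∀ (M₀ : Fin (d + 1) → ℕ), (∀ i, 1 ≤ M₀ i) → ∀ ω : ↥(boxDom fun i => (ℓ + 1) * (2 * M₀ i)) → ℝ,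
        γ₀ * (ω ⬝ᵥ ω) ≤ ω ⬝ᵥ (covOpG n ℓ (fun i => 2 * M₀ i) a a₂ (torLineT L hn ℓ M₀ a s)).mulVec ω ∧
        ω ⬝ᵥ (covOpG n ℓ (fun i => 2 * M₀ i) a a₂ (torLineT L hn ℓ M₀ a s)).mulVec ω ≤ γ₁ * (ω ⬝ᵥ ω) := by
  set γ₀ : ℝ := min (min (aminus / (8 * (d + 1))) (1 / 8) / ((ℓ : ℝ) * (ℓ + 1) / 2)) (a2minus / ((ℓ : ℝ) + 1) ^ 2) with hγ₀
  have hℓ1 : (1 : ℝ) ≤ ℓ := by exact_mod_cast hℓ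
  have hPℓ : (0 : ℝ) < (ℓ : ℝ) * (ℓ + 1) / 2 := by positivity
  have hγ : 0 < γ₀ := lt_min (by positivity) (by positivity)
  refine ⟨γ₀, max γ₀ (|aplus| + |a2plus|), hγ, le_max_left _ _, ?_⟩
  intro n hn a a₂ s h1 h2 h5 h6 hs0 hs1 M₀ hM₀ ω
  have ha₁ : 0 < a := lt_of_lt_of_le ha h1
  have ha₂ : 0 ≤ a₂ := le_trans ha2.le h5
  have hTG := torLineT_mul_inv L hn hM₀ ha₁ hs0 hs1 (ℓ := ℓ)
  have hlev : ∀ g, g ⬝ᵥ (boxOpR n a 0 (fun i => (ℓ + 1) * (2 * M₀ i))).mulVec g ≤ g ⬝ᵥ (torLineT L hn ℓ M₀ a s).mulVec g :=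
    fun g => boxOpR_form_le_torLineT L hn hM₀ a hs0 g
  have hvv0 : 0 ≤ ω ⬝ᵥ ω := by
    unfold dotProduct
    exact Finset.sum_nonneg fun _ _ => mul_self_nonneg _
  constructor
  · have hge := covOpG_form_ge _ hn hℓ ha₁ ha₂ hTG hlev ω
    have hγle : γ₀ ≤ min (min (a / (8 * (d + 1))) (1 / 8) / ((ℓ : ℝ) * (ℓ + 1) / 2)) (a₂ / ((ℓ : ℝ) + 1) ^ 2) := by
      apply min_le_min
      · apply div_le_div_of_nonneg_right _ hPℓ.le
        exact min_le_min (div_le_div_of_nonneg_right h1 (by positivity)) le_rfl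
      · exact div_le_div_of_nonneg_right h5 (by positivity)
    exact (mul_le_mul_of_nonneg_right hγle hvv0).trans hge
  · have hle := covOpG_form_le _ ha₁ ha₂ hTG hlev ω
    have hL2 : a + a₂ / ((ℓ : ℝ) + 1) ^ 2 ≤ max γ₀ (|aplus| + |a2plus|) := by
      refine le_trans ?_ (le_max_right _ _)
      have : a₂ / ((ℓ : ℝ) + 1) ^ 2 ≤ a₂ := div_le_self ha₂ (one_le_pow₀ (by linarith))
      have := le_abs_self aplus
      have := le_abs_self a2plus
      linarith
    exact hle.trans (mul_le_mul_of_nonneg_right hL2 hvv0)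

/-- non-vacuity at `d + 1 = 4`, `L_P = 2`, `L = 3`, window `a, a₂ ∈ [1∕2, 2]`. -/
example : ∃ δ c : ℝ, 0 < δ ∧ 0 < c ∧ ∀ (n : ℕ) (hn : 1 ≤ n) (a a₂ s : ℝ), (1 / 2 : ℝ) ≤ a → a ≤ 2 → (1 / 2 : ℝ) ≤ a₂ → a₂ ≤ 2 →
    0 ≤ s → s ≤ 1 → ∀ (M₀ : Fin (3 + 1) → ℕ), (∀ i, 1 ≤ M₀ i) →
      covOpG n 1 (fun i => 2 * M₀ i) a a₂ (torLineT 3 hn 1 M₀ a s) * (covOpG n 1 (fun i => 2 * M₀ i) a a₂ (torLineT 3 hn 1 M₀ a s))⁻¹ = 1 ∧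
      ∀ y y' : ↥(boxDom fun i => (1 + 1) * (2 * M₀ i)),
        |(covOpG n 1 (fun i => 2 * M₀ i) a a₂ (torLineT 3 hn 1 M₀ a s))⁻¹ y y'| ≤ c * Real.exp (-(δ * rhoT (fun i => (1 + 1) * (2 * M₀ i)) y y')) :=
  cov237T_decay 3 1 le_rfl (1 / 2) 2 (1 / 2) 2 (by norm_num) (by norm_num) 3

end Decay

end Summit.QuantumFields.BalabanUV.T4Continuum.NE7K1LinTorusCov237

end
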